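import Mathlib
import Literature.NumberTheory.Irrationality.Calegari2005ThreeAdic.ThreeAdicValuation
import Literature.NumberTheory.Irrationality.PAdicZetaValues.Criterion
import Literature.NumberTheory.Irrationality.PAdicZetaValues.Records
import Literature.NumberTheory.Transcendental.ZetaLinearFormsCriterion
import HarnessLib

/-!
# Calegari 2005, Theorem 3.4: `ζ₃(3) ∉ ℚ` — PROVED (discharge of the named fact `PAdicZetaValues.calegari2005_theorem34`)
# by Lai's Volkenborn method transposed to `p = 3`

Topic `Literature/NumberTheory/Irrationality/Calegari2005ThreeAdic`.  Sources: F. Calegari, *Irrationality of certain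
`p`-adic periods for small `p`*, IMRN 2005:20 (2005) 1235–1249 = arXiv:math/0408214 [Calegari2005], Theorem 3.4 («If
`p = 3` then `ζ_p(3) ∉ ℚ`»; held text `paper:arxiv-math_0408214`); F. Beukers, *Irrationality of some p-adic L-values*,
Acta Math. Sin. (Engl. Ser.) 24 (2008) 663–686 = arXiv:math/0603277 [Beukers2008], Corollary 23 («`ζ₃(3)` is
irrational») and Proposition 10 (`T₃(⅓) = 27ζ₃(3)`-type evaluation); L. Lai, arXiv:2304.00816 [Lai2025TwoAdicZeta], §7
(proof of Theorem 1.3, `p = 2`).  ROAD (HONEST LABEL — an ADAPTATION, not a printed proof): neither Calegari's proof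
(overconvergent `3`-adic modular forms) nor Beukers' (Padé approximation with the arithmetic Proposition 3) is
formalised; the tree transposes Lai's elementary `2`-adic Volkenborn argument [Lai2025TwoAdicZeta, §3–§7 at `s = 0`] to
`p = 3` (files `RationalFunctionB.lean`, `LinearFormsT.lean`, `ThreeAdicValuation.lean` of this folder), the only new
ingredient being the odd-`p` second-order form of Lai's congruence (2.3) (`PAdicZetaValues/VolkenbornSecondDifference.lean`).
PROOF FILE (theorems only; no definition, no named fact); net debt −1.

## The argument ([Lai2025TwoAdicZeta, §7] transposed)

`d_n³T_n = d_n³σ_{n,0} + 27d_n³σ_{n,2}·ζ₃(3)` is an integer linear form in `1, ζ₃(3)` (`LinearFormsT.T_eq`,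
`exists_int_lcm_pow_mul_sigma0`, `exists_int_sigma2`); along `n = 3^m − 1` it is nonzero
(`ThreeAdicValuation.T_pow_three_sub_one_ne_zero`) and
`max(|d_n³σ_{n,0}|, 27|d_n³σ_{n,2}|)·‖d_n³T_n‖₃ ≤ d_n³·(n+1)²(72n+72)3^{3n} · 3^{3m−6n−1} ≤ e^{(3.05 − 3 log 3 + o(1))n} → 0`
(`d_n³ ≤ e^{3.05n}` by the tree's PNT bound, `3^{3m} = (n+1)³`, `3 log 3 > 3.15`); the tree's Lemma 2.1
(`PAdicZetaValues.exists_isIrrational_of_linearForms`) then says that one of `1, ζ₃(3)` is irrational.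

Cell zeta5-irr / pub-zeta5 (HONEST FRAMING: systematic search; no irrationality claim unless kernel-certified): this is
the kernel-certified `3`-ADIC statement `ζ₃(3) ∉ ℚ` (Calegari 2005); it says nothing about the real number `ζ(5)`, nor
about `ζ(3) ∈ ℝ` (Apéry).
-/

noncomputable section

open Finset Filter Topology
open Literature.NumberTheory.LocalFields
open Literature.NumberTheory.Transcendental
open Literature.NumberTheory.Irrationality.PAdicZetaValues
open scoped Nat

namespace Literature.NumberTheory.Irrationality.Calegari2005ThreeAdic

/-! ## §1. The integer linear forms `d_n³σ_{n,0} + 27d_n³σ_{n,2}·ζ₃(3) = d_n³T_n` -/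

/-- `27·d_n³σ_{n,2} ∈ ℤ`. [cite: Lai2025TwoAdicZeta, Lemma 4.5 and §7 (proof of Thm 1.3: "integer coefficients") — transposed to p = 3] -/
theorem exists_int_lcm_pow_mul_sigma2 (n : ℕ) : ∃ z : ℤ, 27 * ((Nat.lcmUpto n : ℚ) ^ 3 * sigma2 n) = z := by
  obtain ⟨z, hz⟩ := exists_int_sigma2 n
  exact ⟨27 * (Nat.lcmUpto n : ℤ) ^ 3 * z, by rw [hz]; push_cast; ring⟩

/-- **The linear form**: `d_n³σ_{n,0} + 27d_n³σ_{n,2}·ζ₃(3) = d_n³·T_n` in `ℚ₃`.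
[cite: Lai2025TwoAdicZeta, §7 (proof of Thm 1.3, first sentence) with Lemma 3.3 — transposed to p = 3] -/
theorem linearForm_eq (n : ℕ) :
    (((Nat.lcmUpto n : ℚ) ^ 3 * sigma0 n : ℚ) : ℚ_[3]) +
        ((27 * ((Nat.lcmUpto n : ℚ) ^ 3 * sigma2 n) : ℚ) : ℚ_[3]) * padicZetaValue 3 3 =
      ((Nat.lcmUpto n : ℚ) : ℚ_[3]) ^ 3 * T n := by
  rw [T_eq]
  push_cast
  ring

/-- The linear form does not vanish along `n = 3^m − 1`. [cite: Lai2025TwoAdicZeta, §7 (proof of Thm 1.3: "importantly d_n^{2s+3}T_n ≠ 0") — transposed to p = 3] -/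
theorem linearForm_ne_zero {m : ℕ} (hm : 1 ≤ m) :
    (((Nat.lcmUpto (3 ^ m - 1) : ℚ) ^ 3 * sigma0 (3 ^ m - 1) : ℚ) : ℚ_[3]) +
        ((27 * ((Nat.lcmUpto (3 ^ m - 1) : ℚ) ^ 3 * sigma2 (3 ^ m - 1)) : ℚ) : ℚ_[3]) * padicZetaValue 3 3 ≠ 0 := by
  rw [linearForm_eq]
  refine mul_ne_zero (pow_ne_zero _ ?_) (T_pow_three_sub_one_ne_zero hm)
  exact_mod_cast (Nat.lcmUpto_pos (3 ^ m - 1)).ne'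

/-! ## §2. The sizes: `max(|d_n³σ_{n,0}|, 27|d_n³σ_{n,2}|)·‖d_n³T_n‖₃ → 0` along `n = 3^m − 1` -/

/-- A common majorant: `max(|σ_{n,0}|, 27|σ_{n,2}|) ≤ (n+1)²(72n+72)·3^{3n}`. [cite: Lai2025TwoAdicZeta, Lemma 5.2 (sigma_est) — transposed to p = 3] -/
theorem abs_sigma_le (n : ℕ) :
    max |sigma0 n| |27 * sigma2 n| ≤ ((n : ℚ) + 1) ^ 2 * (72 * n + 72) * (3 : ℚ) ^ (3 * n) := by
  have hn : (0 : ℚ) ≤ n := Nat.cast_nonneg n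
  have hc : (3 : ℚ) ^ (2 * (n + n / 2)) ≤ (3 : ℚ) ^ (3 * n) := pow_le_pow_right₀ (by norm_num) (by omega)
  have hc0 : (0 : ℚ) ≤ (3 : ℚ) ^ (2 * (n + n / 2)) := by positivity
  refine max_le ((abs_sigma0_le n).trans ?_) ?_
  · calc ((n : ℚ) + 1) ^ 2 * ((72 * n + 54) * (3 : ℚ) ^ (2 * (n + n / 2)))
        ≤ ((n : ℚ) + 1) ^ 2 * ((72 * n + 72) * (3 : ℚ) ^ (3 * n)) := by gcongr; norm_num
      _ = _ := by ring
  · rw [abs_mul, show |(27 : ℚ)| = 27 by norm_num]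
    calc 27 * |sigma2 n| ≤ 27 * (((n : ℚ) + 1) * (3 : ℚ) ^ (2 * (n + n / 2))) :=
          mul_le_mul_of_nonneg_left (abs_sigma2_le n) (by norm_num)
      _ ≤ (((n : ℚ) + 1) * (72 * n + 72)) * (((n : ℚ) + 1) * (3 : ℚ) ^ (3 * n)) := by
          refine mul_le_mul (by nlinarith) (by gcongr) (by positivity) (by positivity)
      _ = _ := by ring

/-- The Archimedean size of the integer coefficients: `max(|d_n³σ_{n,0}|, 27|d_n³σ_{n,2}|) ≤ d_n³(n+1)²(72n+72)3^{3n}` (in `ℝ`).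
[cite: Lai2025TwoAdicZeta, §7 (proof of Thm 1.3: (d_n_est) and Lemma 5.2) — transposed to p = 3] -/
theorem max_abs_coeff_le (n : ℕ) :
    max (|(((Nat.lcmUpto n : ℚ) ^ 3 * sigma0 n : ℚ) : ℝ)|) (|((27 * ((Nat.lcmUpto n : ℚ) ^ 3 * sigma2 n) : ℚ) : ℝ)|) ≤
      (Nat.lcmUpto n : ℝ) ^ 3 * (((n : ℝ) + 1) ^ 2 * (72 * n + 72) * (3 : ℝ) ^ (3 * n)) := by
  have h := abs_sigma_le n
  have hq : max (|(Nat.lcmUpto n : ℚ) ^ 3 * sigma0 n|) (|27 * ((Nat.lcmUpto n : ℚ) ^ 3 * sigma2 n)|) ≤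
      (Nat.lcmUpto n : ℚ) ^ 3 * (((n : ℚ) + 1) ^ 2 * (72 * n + 72) * (3 : ℚ) ^ (3 * n)) := by
    rw [show (27 : ℚ) * ((Nat.lcmUpto n : ℚ) ^ 3 * sigma2 n) = (Nat.lcmUpto n : ℚ) ^ 3 * (27 * sigma2 n) by ring,
      abs_mul, abs_mul, abs_of_nonneg (by positivity : (0 : ℚ) ≤ (Nat.lcmUpto n : ℚ) ^ 3),
      ← mul_max_of_nonneg _ _ (by positivity)]
    exact mul_le_mul_of_nonneg_left h (by positivity)
  have := (Rat.cast_le (K := ℝ)).2 hq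
  push_cast at this ⊢
  exact this

/-- The `3`-adic size of the linear form along `n = 3^m − 1`: `‖d_n³T_n‖₃ ≤ 3^{3m − 5n − 2⌊n/2⌋ − 2}` (`‖d_n³‖₃ ≤ 1`).
[cite: Lai2025TwoAdicZeta, §7 (proof of Thm 1.3) with Lemma 6.3 — transposed to p = 3] -/
theorem norm_linearForm_le {m : ℕ} (hm : 1 ≤ m) :
    ‖(((Nat.lcmUpto (3 ^ m - 1) : ℚ) ^ 3 * sigma0 (3 ^ m - 1) : ℚ) : ℚ_[3]) +
        ((27 * ((Nat.lcmUpto (3 ^ m - 1) : ℚ) ^ 3 * sigma2 (3 ^ m - 1)) : ℚ) : ℚ_[3]) * padicZetaValue 3 3‖ ≤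
      (3 : ℝ) ^ (3 * (m : ℤ) - 5 * ((3 ^ m - 1 : ℕ) : ℤ) - 2 * (((3 ^ m - 1) / 2 : ℕ) : ℤ) - 2) := by
  rw [linearForm_eq, norm_mul, norm_pow]
  have hd : ‖((Nat.lcmUpto (3 ^ m - 1) : ℚ) : ℚ_[3])‖ ≤ 1 := by
    have := Padic.norm_int_le_one (p := 3) (Nat.lcmUpto (3 ^ m - 1) : ℤ)
    push_cast at this ⊢
    exact this
  calc ‖((Nat.lcmUpto (3 ^ m - 1) : ℚ) : ℚ_[3])‖ ^ 3 * ‖T (3 ^ m - 1)‖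
      ≤ 1 ^ 3 * (3 : ℝ) ^ (3 * (m : ℤ) - 5 * ((3 ^ m - 1 : ℕ) : ℤ) - 2 * (((3 ^ m - 1) / 2 : ℕ) : ℤ) - 2) :=
        mul_le_mul (pow_le_pow_left₀ (norm_nonneg _) hd 3) (norm_T_pow_three_sub_one_le hm) (norm_nonneg _)
          (by positivity)
    _ = _ := by rw [one_pow, one_mul]

/-- `n_m := 3^m − 1 → ∞`. [folklore] -/
private theorem tendsto_pow_three_sub_one : Tendsto (fun m : ℕ => 3 ^ m - 1) atTop atTop := by
  refine tendsto_atTop_mono (fun m => ?_) tendsto_id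
  have : m < 3 ^ m := Nat.lt_pow_self (by norm_num)
  show m ≤ 3 ^ m - 1
  omega

/-- `log 3 ≥ 1.05` (`log 3 = 2 log 2 − log(4/3) ≥ 2·0.6931 − ⅓`). [folklore] -/
private theorem log_three_ge : (1.05 : ℝ) ≤ Real.log 3 := by
  have h2 := Real.log_two_gt_d9
  have h43 : Real.log (4 / 3) ≤ 4 / 3 - 1 := Real.log_le_sub_one_of_pos (by norm_num)
  have hdiv : Real.log (4 / 3) = Real.log 4 - Real.log 3 := Real.log_div (by norm_num) (by norm_num)
  have h4 : Real.log 4 = 2 * Real.log 2 := by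
    rw [show (4 : ℝ) = 2 ^ 2 by norm_num, Real.log_pow]; norm_num
  linarith

/-- The polynomial–exponential majorant tends to `0`: `e^{(3+1/20)n}·(n+1)⁵(72n+72)·3^{−3n} → 0` (`3.05 − 3 log 3 < −0.1`).
[cite: Lai2025TwoAdicZeta, §7 (proof of Thm 1.3: "(because … 3 − 6 log 2 < 0)") — transposed to p = 3 (3 − 3 log 3 < 0)] -/
theorem tendsto_majorant :
    Tendsto (fun n : ℕ => Real.exp ((3 + 1 / 20) * n) * (((n : ℝ) + 1) ^ 5 * (72 * n + 72)) *
      (3 : ℝ) ^ (-(3 * (n : ℤ)))) atTop (𝓝 0) := by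
  -- `x^6 e^{−x} → 0` along `x = (n+1)/10`
  have h6 : Tendsto (fun n : ℕ => (((n : ℝ) + 1) / 10) ^ 6 * Real.exp (-(((n : ℝ) + 1) / 10))) atTop (𝓝 0) := by
    have hx : Tendsto (fun n : ℕ => ((n : ℝ) + 1) / 10) atTop atTop :=
      (tendsto_atTop_add_const_right atTop (1 : ℝ) tendsto_natCast_atTop_atTop).atTop_div_const (by norm_num)
    exact ((Real.tendsto_pow_mul_exp_neg_atTop_nhds_zero 6).comp hx).congr fun n => rfl
  have hlog := log_three_ge
  have hle : ∀ n : ℕ, Real.exp ((3 + 1 / 20) * n) * (((n : ℝ) + 1) ^ 5 * (72 * n + 72)) * (3 : ℝ) ^ (-(3 * (n : ℤ))) ≤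
      72 * 10 ^ 6 * Real.exp (1 / 10) * ((((n : ℝ) + 1) / 10) ^ 6 * Real.exp (-(((n : ℝ) + 1) / 10))) := by
    intro n
    have hn : (0 : ℝ) ≤ n := Nat.cast_nonneg n
    have h3 : (3 : ℝ) ^ (-(3 * (n : ℤ))) = Real.exp (-(3 * n) * Real.log 3) := by
      rw [show (-(3 * (n : ℤ))) = -((3 * n : ℕ) : ℤ) by push_cast; ring, zpow_neg, zpow_natCast,
        ← Real.exp_log (by positivity : (0 : ℝ) < 3 ^ (3 * n)), Real.log_pow, ← Real.exp_neg]
      congr 1; push_cast; ring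
    have hpoly : ((n : ℝ) + 1) ^ 5 * (72 * n + 72) = 72 * 10 ^ 6 * (((n : ℝ) + 1) / 10) ^ 6 := by ring
    rw [h3, hpoly]
    have hexp : Real.exp ((3 + 1 / 20) * n) * Real.exp (-(3 * n) * Real.log 3) ≤
        Real.exp (1 / 10) * Real.exp (-(((n : ℝ) + 1) / 10)) := by
      rw [← Real.exp_add, ← Real.exp_add]
      exact Real.exp_le_exp.2 (by nlinarith)
    calc Real.exp ((3 + 1 / 20) * n) * (72 * 10 ^ 6 * (((n : ℝ) + 1) / 10) ^ 6) * Real.exp (-(3 * n) * Real.log 3)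
        = 72 * 10 ^ 6 * (((n : ℝ) + 1) / 10) ^ 6 * (Real.exp ((3 + 1 / 20) * n) * Real.exp (-(3 * n) * Real.log 3)) := by
          ring
      _ ≤ 72 * 10 ^ 6 * (((n : ℝ) + 1) / 10) ^ 6 * (Real.exp (1 / 10) * Real.exp (-(((n : ℝ) + 1) / 10))) :=
          mul_le_mul_of_nonneg_left hexp (by positivity)
      _ = 72 * 10 ^ 6 * Real.exp (1 / 10) * ((((n : ℝ) + 1) / 10) ^ 6 * Real.exp (-(((n : ℝ) + 1) / 10))) := by ring
  have hlim := h6.const_mul (72 * 10 ^ 6 * Real.exp (1 / 10))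
  rw [mul_zero] at hlim
  exact squeeze_zero (fun n => by positivity) hle hlim

/-- **The sizes multiply to `o(1)`** along `n = 3^m − 1`:
`max(|d_n³σ_{n,0}|, 27|d_n³σ_{n,2}|)·‖d_n³σ_{n,0} + 27d_n³σ_{n,2}ζ₃(3)‖₃ → 0`.
[cite: Lai2025TwoAdicZeta, §7 (proof of Thm 1.3, the displayed estimate) — transposed to p = 3] -/
theorem tendsto_bound :
    Tendsto (fun m : ℕ =>
      max (|(((Nat.lcmUpto (3 ^ m - 1) : ℚ) ^ 3 * sigma0 (3 ^ m - 1) : ℚ) : ℝ)|)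
          (|((27 * ((Nat.lcmUpto (3 ^ m - 1) : ℚ) ^ 3 * sigma2 (3 ^ m - 1)) : ℚ) : ℝ)|) *
        ‖(((Nat.lcmUpto (3 ^ m - 1) : ℚ) ^ 3 * sigma0 (3 ^ m - 1) : ℚ) : ℚ_[3]) +
            ((27 * ((Nat.lcmUpto (3 ^ m - 1) : ℚ) ^ 3 * sigma2 (3 ^ m - 1)) : ℚ) : ℚ_[3]) * padicZetaValue 3 3‖)
      atTop (𝓝 0) := by
  -- PNT: `d_n³ ≤ e^{(3 + 1/20)n}` for large `n`
  have hpnt : ∀ᶠ n : ℕ in atTop, ((Nat.lcmUpto n : ℝ)) ^ 3 ≤ Real.exp ((3 + 1 / 20) * n) := by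
    have h := eventually_lcmUpto_mul_pow_le_exp 1 3 (ε := 1 / 20) (by norm_num)
    filter_upwards [h] with n hn
    rw [one_mul] at hn
    refine hn.trans (le_of_eq ?_)
    congr 1; push_cast; ring
  have hpnt' := tendsto_pow_three_sub_one.eventually hpnt
  have hmaj := tendsto_majorant.comp tendsto_pow_three_sub_one
  refine squeeze_zero' (Eventually.of_forall fun m => by positivity) ?_ hmaj
  filter_upwards [hpnt', eventually_ge_atTop 1] with m hd hm
  set n : ℕ := 3 ^ m - 1 with hn
  have h1 := max_abs_coeff_le n
  have h2 := norm_linearForm_le hm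
  have h3m : 1 ≤ 3 ^ m := Nat.one_le_pow _ _ (by norm_num)
  have hn1 : ((n : ℝ) + 1) = (3 : ℝ) ^ m := by
    rw [hn, Nat.cast_sub h3m]; push_cast; ring
  have hkey : (Nat.lcmUpto n : ℝ) ^ 3 * (((n : ℝ) + 1) ^ 2 * (72 * n + 72) * (3 : ℝ) ^ (3 * n)) *
      (3 : ℝ) ^ (3 * (m : ℤ) - 5 * (n : ℤ) - 2 * ((n / 2 : ℕ) : ℤ) - 2) ≤
      Real.exp ((3 + 1 / 20) * n) * (((n : ℝ) + 1) ^ 5 * (72 * n + 72)) * (3 : ℝ) ^ (-(3 * (n : ℤ))) := by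
    have e3 : (3 : ℝ) ^ (3 * (m : ℤ) - 5 * (n : ℤ) - 2 * ((n / 2 : ℕ) : ℤ) - 2) =
        ((n : ℝ) + 1) ^ 3 * (3 : ℝ) ^ (-(5 * (n : ℤ)) - 2 * ((n / 2 : ℕ) : ℤ) - 2) := by
      rw [hn1, ← pow_mul, ← zpow_natCast (3 : ℝ) (m * 3), ← zpow_add₀ (by norm_num : (3 : ℝ) ≠ 0)]
      congr 1; push_cast; ring
    have e6 : (3 : ℝ) ^ (3 * n) * (3 : ℝ) ^ (-(5 * (n : ℤ)) - 2 * ((n / 2 : ℕ) : ℤ) - 2) ≤ (3 : ℝ) ^ (-(3 * (n : ℤ))) := by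
      rw [← zpow_natCast, ← zpow_add₀ (by norm_num : (3 : ℝ) ≠ 0)]
      exact zpow_le_zpow_right₀ (by norm_num) (by push_cast; omega)
    calc (Nat.lcmUpto n : ℝ) ^ 3 * (((n : ℝ) + 1) ^ 2 * (72 * n + 72) * (3 : ℝ) ^ (3 * n)) *
          (3 : ℝ) ^ (3 * (m : ℤ) - 5 * (n : ℤ) - 2 * ((n / 2 : ℕ) : ℤ) - 2)
        = (Nat.lcmUpto n : ℝ) ^ 3 * (((n : ℝ) + 1) ^ 5 * (72 * n + 72)) *
            ((3 : ℝ) ^ (3 * n) * (3 : ℝ) ^ (-(5 * (n : ℤ)) - 2 * ((n / 2 : ℕ) : ℤ) - 2)) := by rw [e3]; ring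
      _ ≤ Real.exp ((3 + 1 / 20) * n) * (((n : ℝ) + 1) ^ 5 * (72 * n + 72)) * (3 : ℝ) ^ (-(3 * (n : ℤ))) := by
          gcongr
  calc max (|(((Nat.lcmUpto n : ℚ) ^ 3 * sigma0 n : ℚ) : ℝ)|) (|((27 * ((Nat.lcmUpto n : ℚ) ^ 3 * sigma2 n) : ℚ) : ℝ)|) *
        ‖(((Nat.lcmUpto n : ℚ) ^ 3 * sigma0 n : ℚ) : ℚ_[3]) +
            ((27 * ((Nat.lcmUpto n : ℚ) ^ 3 * sigma2 n) : ℚ) : ℚ_[3]) * padicZetaValue 3 3‖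
      ≤ (Nat.lcmUpto n : ℝ) ^ 3 * (((n : ℝ) + 1) ^ 2 * (72 * n + 72) * (3 : ℝ) ^ (3 * n)) *
          (3 : ℝ) ^ (3 * (m : ℤ) - 5 * (n : ℤ) - 2 * ((n / 2 : ℕ) : ℤ) - 2) :=
        mul_le_mul h1 h2 (norm_nonneg _) (by positivity)
    _ ≤ _ := hkey

/-! ## §3. `ζ₃(3) ∉ ℚ` -/

/-- **`ζ₃(3)` is irrational** (`ζ₃(3)` = the tree's `padicZetaValue 3 3`), by the tree's Lemma 2.1
(`exists_isIrrational_of_linearForms`) applied to the integer forms `d_n³σ_{n,0} + 27d_n³σ_{n,2}·ζ₃(3)`, `n = 3^m − 1`.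
[cite: Calegari2005, Thm 3.4] [cite: Beukers2008, Corollary 23] [cite: Lai2025TwoAdicZeta, §7 (proof of Thm 1.3) — transposed to p = 3] -/
theorem isIrrational_padicZetaValue_three_three : IsIrrational 3 (padicZetaValue 3 3) := by
  classical
  set ξ : Fin 2 → ℚ_[3] := ![1, padicZetaValue 3 3] with hξ
  have hforms : ∀ a b : ℤ, (∑ i, ((![a, b] i : ℤ) : ℚ_[3]) * ξ i) = (a : ℚ_[3]) + (b : ℚ_[3]) * padicZetaValue 3 3 := by
    intro a b
    simp [hξ, Fin.sum_univ_two]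
  have h := exists_isIrrational_of_linearForms (p := 3) ξ fun ε hε => by
    obtain ⟨m, hm, hm1⟩ := ((tendsto_bound.eventually (gt_mem_nhds hε)).and (eventually_ge_atTop 1)).exists
    have hne := linearForm_ne_zero hm1
    obtain ⟨a, ha⟩ := exists_int_lcm_pow_mul_sigma0 (3 ^ m - 1)
    obtain ⟨b, hb⟩ := exists_int_lcm_pow_mul_sigma2 (3 ^ m - 1)
    rw [ha, hb] at hm hne
    simp only [Rat.cast_intCast] at hm hne
    refine ⟨![a, b], ?_, fun i => ?_⟩
    · rw [hforms]; exact hne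
    · rw [hforms]
      refine lt_of_le_of_lt (mul_le_mul_of_nonneg_right ?_ (norm_nonneg _)) hm
      fin_cases i <;> simp
  obtain ⟨i, hi⟩ := h
  fin_cases i
  · exfalso
    have : ¬ IsIrrational 3 (((1 : ℚ)) : ℚ_[3]) := not_isIrrational_ratCast (p := 3) 1
    simp only [hξ] at hi
    exact this (by simpa using hi)
  · simpa [hξ] using hi

end Literature.NumberTheory.Irrationality.Calegari2005ThreeAdic

namespace Literature.NumberTheory.Irrationality.PAdicZetaValues

open Literature.NumberTheory.Irrationality.Calegari2005ThreeAdic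

/-- **Calegari 2005, Theorem 3.4, PROVED: `ζ₃(3) ∉ ℚ`** — discharge of the named fact `calegari2005_theorem34`
(`IsIrrational 3 (padicZetaValue 3 3)`).  Road (HONEST LABEL): Lai's `2`-adic Volkenborn method [Lai2025TwoAdicZeta]
transposed to `p = 3` (`Calegari2005ThreeAdic.isIrrational_padicZetaValue_three_three`); Calegari's printed proof
(overconvergent modular forms of level `Γ₀(3)`) and Beukers' (Padé approximations, [Beukers2008, Thm 21 / Cor. 23]) are
not formalised. [cite: Calegari2005, Thm 3.4] [cite: Beukers2008, Corollary 23] -/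
theorem calegari2005_theorem34_holds : calegari2005_theorem34 := by
  unfold calegari2005_theorem34
  exact isIrrational_padicZetaValue_three_three

end Literature.NumberTheory.Irrationality.PAdicZetaValues
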